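import Summits.BirchSwinnertonDyer.BirchSwinnertonDyer.Theorems.KimAtThreeFineKatoKPortReduction
import Summits.BirchSwinnertonDyer.BirchSwinnertonDyer.Theorems.KimAtThreeFineKatoKPortNormTrace
import Literature.NumberTheory.EllipticCurves.ReductionHomomorphismUnitCriterionProofs
import Literature.NumberTheory.EllipticCurves.ComplexMultiplicationCoatesWilesReductionIndexProofs
import Literature.NumberTheory.EllipticCurves.TamagawaSubgroupProofs
import HarnessLib

/-!
# K-PORT glue (toward G7): `E₀(K)` in NORM terms, its GALOIS-invariance, its DESCENT to `ℚ_p`, and the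
# bridge to the `ℤ_p`-currency `goodReductionSubgroup ℤ_[p]` of the `ℚ_p`-side files
# (cell `bsd-addord`, seat w2-kport gen 0; `--supports stmt-BirchSwinnertonDyer-19560`, helper)

HONEST FRAMING. Route W2 (`route-BirchSwinnertonDyer-KimAtThreeKolyvagin`), crux 19560
`KatoKuriharaPortThreeShared`, residual ⟨C1⟩ clause (C1.c): kim3's CONSUMER THEOREM for SAT₀ quantifies
over `E₀(K)` (points of nonsingular reduction of `W ⊗ K_w`) and descends a norm point to `E₀(ℚ₃)` in the
currency `X.goodReductionSubgroup ℤ_[3]` of kim3 g12's `KimAtThreeFineKatoSATPoints`. The K-side `E₀(K)`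
of the port is the tree's `(M.map (BallEval.coeffHom p K)).nonsingularReductionSubgroup hv`
(`…KPortReduction`). This file makes it computable and moves it across fields: by the tree's
valuation criterion (`ReductionHomomorphismUnitCriterionProofs`: `P ∈ E₀ ↔ v(x) > 1 ∨` a partial
derivative of the Weierstrass polynomial is a unit) membership in `E₀(K)` is a statement about NORMS of
polynomial expressions in the coordinates with coefficients from `ℚ_p`, hence invariant under isometric
`ℚ_p`-algebra maps — Galois automorphisms (`σ E₀(K) = E₀(K)`, so `N(P) = ∑ σP ∈ E₀(K)`) and the inclusion
`ι : E(ℚ_p) → E(K)` (`ι⁻¹ E₀(K) = E₀(ℚ_p)`) — and `E₀(ℚ_p)` in the `unitBall ℚ_p`-currency is the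
`ℤ_p`-currency `goodReductionSubgroup ℤ_[p]` (tree's `TamagawaSubgroupProofs` + `padicInt_valuationIntegers`).
TOOL theorems only (no definition, no named fact, no `sorry`); closes nothing by itself; nothing booked.

## What is proved (`E = curveK p K M`, `E₀(K) = (M.map (coeffHom p K)).nonsingularReductionSubgroup hv`,
`X = M ⊗ ℚ_p`, `ι = Affine.Point.map (Algebra.ofId ℚ_[p] K)`)

* §1 **`some_mem_nonsingularReductionSubgroup_iff_norm`**: `(x, y) ∈ E₀(K) ↔ 1 < ‖x‖ ∨
  ‖a₁y − (3x² + 2a₂x + a₄)‖ = 1 ∨ ‖2y + a₁x + a₃‖ = 1` (coefficients of `E`).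
* §2 **`map_mem_nonsingularReductionSubgroup_iff`** (isometric `φ : K →ₐ[ℚ_[p]] K'`: `T_φ P ∈ E₀(K') ↔
  P ∈ E₀(K)`), `galois_mem_nonsingularReductionSubgroup_iff`, `sum_galois_mem_nonsingularReductionSubgroup`
  (`N(P) ∈ E₀(K)` for `P ∈ E₀(K)`), `map_ofId_mem_nonsingularReductionSubgroup_iff` (descent to
  `E₀(ℚ_p)` in the `unitBall ℚ_p`-currency).
* §3 `ℤ_p`-currency: `mem_nonsingularReductionSubgroup_padic_iff_hasNonsingularReduction`
  (`unitBall ℚ_p`-model vs `ℤ_p`-model `M`: same predicate), **`map_ofId_mem_nonsingularReductionSubgroup_iff_mem_goodReductionSubgroup`**: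
  for `X = M ⊗ ℚ_p` minimal, `ι P₀ ∈ E₀(K) ↔ P₀ ∈ X.goodReductionSubgroup ℤ_[p]` — the hand-over to kim3's
  `ℚ₃`-side theorems.

References: J. H. Silverman, *The Arithmetic of Elliptic Curves*, 2nd ed. (2009), III.1, VII.2 Prop. 2.1
[SilvermanAEC2009]; kim3 brief HOME/kim3/KIM3-KPORT-BRIEF-g12.md §3 (P3, consumer theorem).
-/

noncomputable section

-- the cell's Theorems namespace `Summit.BirchSwinnertonDyer.BirchSwinnertonDyer.…` repeats the summit name by design (D-0017)
set_option linter.dupNamespace false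

open scoped Classical

namespace Summit.BirchSwinnertonDyer.BirchSwinnertonDyer.Theorems.KPort

open Summit.BirchSwinnertonDyer.Rank1Residual.Additive.BallEval
open Literature.NumberTheory.GaloisRepresentations.LubinTate (unitBall mem_unitBall_iff)
open Literature.NumberTheory.EllipticCurves Literature.NumberTheory.EllipticCurves.FormalGroupChart
open WeierstrassCurve

variable {p : ℕ} [hp : Fact p.Prime] {M : WeierstrassCurve ℤ_[p]}

/-! ## §1 `E₀(K)` by norms -/

section Norm

variable {K : Type*} [NontriviallyNormedField K] [NormedAlgebra ℚ_[p] K] [IsUltrametricDist K]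

/-- `v(z) = 1 ↔ ‖z‖ = 1` and `1 < v(z) ↔ 1 < ‖z‖` for the norm valuation. [folklore] -/
theorem normedValuation_eq_one_iff (z : K) : NormedField.valuation (K := K) z = 1 ↔ ‖z‖ = 1 := by
  rw [← NNReal.coe_inj, NormedField.valuation_apply, coe_nnnorm, NNReal.coe_one]

/-- `1 < v(z) ↔ 1 < ‖z‖` for the norm valuation. [folklore] -/
theorem one_lt_normedValuation_iff (z : K) : 1 < NormedField.valuation (K := K) z ↔ 1 < ‖z‖ := by
  rw [← NNReal.coe_lt_coe, NormedField.valuation_apply, coe_nnnorm, NNReal.coe_one]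

/-- **`E₀(K)` by norms**: an affine point `(x, y)` of `E = M ⊗ K` has nonsingular reduction iff
`‖x‖ > 1` or one of the partial-derivative expressions of the Weierstrass polynomial at `(x, y)` has
norm `1`. [cite: SilvermanAEC2009, VII.2 Prop. 2.1 and III.1] -/
theorem some_mem_nonsingularReductionSubgroup_iff_norm {x y : K} (h : (curveK p K M).toAffine.Nonsingular x y) :
    (Affine.Point.some x y h : (curveK p K M).toAffine.Point) ∈
        (M.map (coeffHom p K)).nonsingularReductionSubgroup
          (Valuation.integer.integers (NormedField.valuation (K := K))) ↔
      1 < ‖x‖ ∨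
        ‖(curveK p K M).a₁ * y - (3 * x ^ 2 + 2 * (curveK p K M).a₂ * x + (curveK p K M).a₄)‖ = 1 ∨
          ‖2 * y + (curveK p K M).a₁ * x + (curveK p K M).a₃‖ = 1 := by
  have key := (M.map (coeffHom p K)).some_mem_nonsingularReductionSubgroup_iff_valuation
    (Valuation.integer.integers (NormedField.valuation (K := K))) h
  rw [one_lt_normedValuation_iff, normedValuation_eq_one_iff, normedValuation_eq_one_iff] at key
  exact key

end Norm

/-! ## §2 Invariance under isometric `ℚ_p`-algebra maps: Galois and base change -/

section Maps

variable {K : Type*} [NontriviallyNormedField K] [NormedAlgebra ℚ_[p] K] [IsUltrametricDist K]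
  {K' : Type*} [NontriviallyNormedField K'] [NormedAlgebra ℚ_[p] K'] [IsUltrametricDist K']

/-- The coefficients of `M ⊗ K` are images of those of `M ⊗ ℚ_p`, hence fixed by `ℚ_p`-algebra maps. [folklore] -/
theorem map_curveK_a (φ : K →ₐ[ℚ_[p]] K') :
    φ (curveK p K M).a₁ = (curveK p K' M).a₁ ∧ φ (curveK p K M).a₂ = (curveK p K' M).a₂ ∧
      φ (curveK p K M).a₃ = (curveK p K' M).a₃ ∧ φ (curveK p K M).a₄ = (curveK p K' M).a₄ ∧
        φ (curveK p K M).a₆ = (curveK p K' M).a₆ :=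
  ⟨AlgHom.commutes φ _, AlgHom.commutes φ _, AlgHom.commutes φ _, AlgHom.commutes φ _, AlgHom.commutes φ _⟩

/-- **`T_φ P ∈ E₀(K') ↔ P ∈ E₀(K)`** for an isometric `ℚ_p`-algebra map `φ : K → K'`.
[cite: SilvermanAEC2009, VII.2 Prop. 2.1] -/
theorem map_mem_nonsingularReductionSubgroup_iff (φ : K →ₐ[ℚ_[p]] K') (hφ : ∀ x, ‖φ x‖ = ‖x‖)
    (P : (curveK p K M).toAffine.Point) :
    (Affine.Point.map (W' := (M.map PadicInt.Coe.ringHom).toAffine) φ P :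
          (curveK p K' M).toAffine.Point) ∈
        (M.map (coeffHom p K')).nonsingularReductionSubgroup
          (Valuation.integer.integers (NormedField.valuation (K := K'))) ↔
      P ∈ (M.map (coeffHom p K)).nonsingularReductionSubgroup
          (Valuation.integer.integers (NormedField.valuation (K := K))) := by
  rcases P with _ | ⟨x, y, h⟩
  · exact ⟨fun _ => AddSubgroup.zero_mem _, fun _ => AddSubgroup.zero_mem _⟩
  · obtain ⟨h₁, h₂, h₃, h₄, -⟩ := map_curveK_a (M := M) φ
    change (Affine.Point.some (φ x) (φ y) _ : (curveK p K' M).toAffine.Point) ∈ _ ↔ _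
    rw [some_mem_nonsingularReductionSubgroup_iff_norm, some_mem_nonsingularReductionSubgroup_iff_norm,
      ← h₁, ← h₂, ← h₃, ← h₄]
    have e₁ : φ (curveK p K M).a₁ * φ y - (3 * φ x ^ 2 + 2 * φ (curveK p K M).a₂ * φ x + φ (curveK p K M).a₄) =
        φ ((curveK p K M).a₁ * y - (3 * x ^ 2 + 2 * (curveK p K M).a₂ * x + (curveK p K M).a₄)) := by
      simp only [map_sub, map_add, map_mul, map_pow, map_ofNat]
    have e₂ : 2 * φ y + φ (curveK p K M).a₁ * φ x + φ (curveK p K M).a₃ =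
        φ (2 * y + (curveK p K M).a₁ * x + (curveK p K M).a₃) := by
      simp only [map_add, map_mul, map_ofNat]
    rw [e₁, e₂, hφ, hφ, hφ]

/-- `σ P ∈ E₀(K) ↔ P ∈ E₀(K)` for `σ ∈ Gal(K/ℚ_p)`, `K/ℚ_p` algebraic. [cite: SilvermanAEC2009, VII.2 Prop. 2.1] -/
theorem galois_mem_nonsingularReductionSubgroup_iff [Algebra.IsAlgebraic ℚ_[p] K] (σ : K ≃ₐ[ℚ_[p]] K)
    (P : (curveK p K M).toAffine.Point) :
    (Affine.Point.map (W' := (M.map PadicInt.Coe.ringHom).toAffine) (σ : K →ₐ[ℚ_[p]] K) P :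
          (curveK p K M).toAffine.Point) ∈
        (M.map (coeffHom p K)).nonsingularReductionSubgroup
          (Valuation.integer.integers (NormedField.valuation (K := K))) ↔
      P ∈ (M.map (coeffHom p K)).nonsingularReductionSubgroup
          (Valuation.integer.integers (NormedField.valuation (K := K))) :=
  map_mem_nonsingularReductionSubgroup_iff (σ : K →ₐ[ℚ_[p]] K) (norm_algEquiv_eq σ) P

/-- **`N(P) = ∑_σ σP ∈ E₀(K)` for `P ∈ E₀(K)`** (`K/ℚ_p` finite). [cite: SilvermanAEC2009, VII.2 Prop. 2.1] -/
theorem sum_galois_mem_nonsingularReductionSubgroup [FiniteDimensional ℚ_[p] K] {P : (curveK p K M).toAffine.Point}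
    (hP : P ∈ (M.map (coeffHom p K)).nonsingularReductionSubgroup
      (Valuation.integer.integers (NormedField.valuation (K := K)))) :
    (∑ σ : K ≃ₐ[ℚ_[p]] K,
        Affine.Point.map (W' := (M.map PadicInt.Coe.ringHom).toAffine) (σ : K →ₐ[ℚ_[p]] K) P) ∈
      (M.map (coeffHom p K)).nonsingularReductionSubgroup
        (Valuation.integer.integers (NormedField.valuation (K := K))) := by
  haveI : Algebra.IsAlgebraic ℚ_[p] K := Algebra.IsAlgebraic.of_finite ℚ_[p] K
  refine Finset.sum_induction _ (fun Q => Q ∈ (M.map (coeffHom p K)).nonsingularReductionSubgroup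
      (Valuation.integer.integers (NormedField.valuation (K := K)))) (fun a b ha hb => ?_) ?_ ?_
  · exact AddSubgroup.add_mem _ ha hb
  · exact AddSubgroup.zero_mem _
  · intro σ _
    exact (galois_mem_nonsingularReductionSubgroup_iff σ P).mpr hP

/-- **Descent: `ι P₀ ∈ E₀(K) ↔ P₀ ∈ E₀(ℚ_p)`** (the latter in the `unitBall ℚ_p`-currency
`(M.map (coeffHom p ℚ_[p])).nonsingularReductionSubgroup`). [cite: SilvermanAEC2009, VII.2 Prop. 2.1] -/
theorem map_ofId_mem_nonsingularReductionSubgroup_iff (P₀ : (M.map PadicInt.Coe.ringHom).toAffine.Point) :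
    (Affine.Point.map (W' := (M.map PadicInt.Coe.ringHom).toAffine) (Algebra.ofId ℚ_[p] K) P₀ :
          (curveK p K M).toAffine.Point) ∈
        (M.map (coeffHom p K)).nonsingularReductionSubgroup
          (Valuation.integer.integers (NormedField.valuation (K := K))) ↔
      (P₀ : (curveK p ℚ_[p] M).toAffine.Point) ∈ (M.map (coeffHom p ℚ_[p])).nonsingularReductionSubgroup
          (Valuation.integer.integers (NormedField.valuation (K := ℚ_[p]))) :=
  map_mem_nonsingularReductionSubgroup_iff (K := ℚ_[p]) (Algebra.ofId ℚ_[p] K) norm_ofId_eq P₀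

end Maps

/-! ## §3 The `ℤ_p`-currency of the `ℚ_p`-side files -/

section PadicSide

/-- The `unitBall ℚ_p`-model and the `ℤ_p`-model `M` have the same predicate "nonsingular reduction"
on `X = M ⊗ ℚ_p`-points (both are the valuation criterion for `‖·‖_p`). [cite: SilvermanAEC2009, VII.2 Prop. 2.1] -/
theorem mem_nonsingularReductionSubgroup_padic_iff_hasNonsingularReduction
    (P₀ : (M.map PadicInt.Coe.ringHom).toAffine.Point) :
    (P₀ : (curveK p ℚ_[p] M).toAffine.Point) ∈ (M.map (coeffHom p ℚ_[p])).nonsingularReductionSubgroup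
          (Valuation.integer.integers (NormedField.valuation (K := ℚ_[p]))) ↔
      M.HasNonsingularReduction (K := ℚ_[p]) P₀ := by
  rcases P₀ with _ | ⟨x, y, h⟩
  · exact ⟨fun _ => trivial, fun _ => AddSubgroup.zero_mem _⟩
  · have h' : (M.baseChange ℚ_[p]).toAffine.Nonsingular x y := h
    exact ((M.map (coeffHom p ℚ_[p])).some_mem_nonsingularReductionSubgroup_iff_valuation
      (Valuation.integer.integers (NormedField.valuation (K := ℚ_[p]))) h).trans
      (M.hasNonsingularReduction_some_iff_valuation (padicInt_valuationIntegers p) h').symm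

/-- **Hand-over to the `ℚ_p`-side currency**: for `X = M ⊗ ℚ_p` minimal at `p` (`[X.IsMinimal ℤ_[p]]`;
e.g. `M = W_ℤ ⊗ ℤ_p` for a globally minimal `W/ℚ`), `ι P₀ ∈ E₀(K) ↔ P₀ ∈ X.goodReductionSubgroup ℤ_[p]`
(the tree's `mem_goodReductionSubgroup_iff_holds` + `isNonsingularReductionPoint_iff_hasNonsingularReduction`).
[cite: SilvermanAEC2009, VII.2 Prop. 2.1] -/
theorem map_ofId_mem_nonsingularReductionSubgroup_iff_mem_goodReductionSubgroup
    {K : Type*} [NontriviallyNormedField K] [NormedAlgebra ℚ_[p] K] [IsUltrametricDist K]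
    [(M.map PadicInt.Coe.ringHom).IsMinimal ℤ_[p]] (P₀ : (M.map PadicInt.Coe.ringHom).toAffine.Point) :
    (Affine.Point.map (W' := (M.map PadicInt.Coe.ringHom).toAffine) (Algebra.ofId ℚ_[p] K) P₀ :
          (curveK p K M).toAffine.Point) ∈
        (M.map (coeffHom p K)).nonsingularReductionSubgroup
          (Valuation.integer.integers (NormedField.valuation (K := K))) ↔
      P₀ ∈ (M.map PadicInt.Coe.ringHom).goodReductionSubgroup ℤ_[p] := by
  haveI : (M.baseChange ℚ_[p]).IsMinimal ℤ_[p] := ‹(M.map PadicInt.Coe.ringHom).IsMinimal ℤ_[p]›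
  rw [map_ofId_mem_nonsingularReductionSubgroup_iff, mem_nonsingularReductionSubgroup_padic_iff_hasNonsingularReduction]
  have h := (M.map PadicInt.Coe.ringHom).mem_goodReductionSubgroup_iff_holds ℤ_[p] P₀
  rw [h]
  exact (isNonsingularReductionPoint_iff_hasNonsingularReduction ℤ_[p] M P₀).symm

end PadicSide

end Summit.BirchSwinnertonDyer.BirchSwinnertonDyer.Theorems.KPort

end
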